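import Summits.RiemannHypothesis.RiemannHypothesis.Theorems.HandoffCross
import Summits.RiemannHypothesis.RiemannHypothesis.Theorems.HandoffSliver
import HarnessLib

/-!
# HANDOFF: the atom `q` is purely OFF-DIAGONAL in the inner/edge split (rh-explicit, track «HANDOFF», seat prove-2, ATTEMPT-2 §2 CLAIM)

HONEST FRAMING. Nothing here bears on RH. ATTEMPT-2 §2 claims that in the Schur split `g = u + h` of a test function on the
HANDOFF window (`u` supported in the inner window `[−c, c]`, `c = (log q)/2`; `h` an edge-layer function vanishing on the open
core `(−c, c)`, supported in `[−b, b]` with `b < 2c`), the spike `k_g(log q)` of `k_g = g ⋆ g̃` that carries the contribution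
of the prime `q` has NO self terms: `k_u(log q) = 0` (point overlap), `k_h(log q) = 0` (the two lobes are too far apart and
too close), so `k_g(log q) = (u ⋆ h̃)(log q) + (h ⋆ ũ)(log q)` — the atom `q` couples the inner window to the edge layer and
nothing else. All PROVED here (sharp cut; the `η`-overlap version differs by an `O(η)` self term, not treated). Also records
`sliverBound_holds : SliverBound` (the Prop stated in `HandoffSchur.lean`, proved in `HandoffSliver.lean`).
-/

set_option linter.dupNamespace false

noncomputable section

open Complex Filter Set MeasureTheory Literature.NumberTheory.LFunctions
open scoped Real Topology ComplexConjugate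

namespace Summit.RiemannHypothesis.RiemannHypothesis.Theorems.Handoff

variable {u h : ℝ → ℂ}

/-- **Point overlap**: for `tsupport u ⊆ [−c, c]`, `(u ⋆ ũ)(2c) = 0` (the integrand lives on `{t = c}`). [folklore] -/
theorem weilConv_weilReflect_self_apply_two_mul {c : ℝ} (hu : tsupport u ⊆ Icc (-c) c) :
    weilConv u (weilReflect u) (2 * c) = 0 := by
  rw [weilConv_weilReflect_eq_integral]
  refine integral_eq_zero_of_ae ?_
  have hae : ∀ᵐ t : ℝ, t ≠ c := by
    have : ({c} : Set ℝ)ᶜ ∈ ae volume := compl_mem_ae_iff.2 (measure_singleton c)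
    filter_upwards [this] with t ht using ht
  filter_upwards [hae] with t ht
  by_cases h1 : u t = 0
  · simp [h1]
  by_cases h2 : u (t - 2 * c) = 0
  · simp [h2]
  have ht1 := hu (subset_tsupport _ (Function.mem_support.2 h1))
  have ht2 := hu (subset_tsupport _ (Function.mem_support.2 h2))
  exfalso
  exact ht (le_antisymm ht1.2 (by linarith [ht2.1]))

/-- **Lobes too far and too close**: for an edge-layer function `h` (supported in `[−b, b]`, vanishing on `(−c, c)`, `0 < c`,
`b < 2c`), `(h ⋆ h̃)(2c) = 0`. [this track, ATTEMPT-2 §2] -/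
theorem weilConv_weilReflect_edge_apply_two_mul {c b : ℝ} (hc : 0 < c) (hb : b < 2 * c)
    (hsupp : tsupport h ⊆ Icc (-b) b) (hcore : ∀ x : ℝ, -c < x → x < c → h x = 0) :
    weilConv h (weilReflect h) (2 * c) = 0 := by
  rw [weilConv_weilReflect_eq_integral]
  refine integral_eq_zero_of_ae ?_
  have hae : ∀ᵐ t : ℝ, t ≠ c := by
    have : ({c} : Set ℝ)ᶜ ∈ ae volume := compl_mem_ae_iff.2 (measure_singleton c)
    filter_upwards [this] with t ht using ht
  filter_upwards [hae] with t ht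
  by_cases h1 : h t = 0
  · simp [h1]
  by_cases h2 : h (t - 2 * c) = 0
  · simp [h2]
  have ht1 := hsupp (subset_tsupport _ (Function.mem_support.2 h1))
  have ht2 := hsupp (subset_tsupport _ (Function.mem_support.2 h2))
  exfalso
  -- t ∈ [-b, b], t - 2c ∈ [-b, b]; h(t - 2c) ≠ 0 forces t - 2c ∉ (-c, c)
  have hnot2 : ¬(-c < t - 2 * c ∧ t - 2 * c < c) := fun hh ↦ h2 (hcore _ hh.1 hh.2)
  have hnot1 : ¬(-c < t ∧ t < c) := fun hh ↦ h1 (hcore _ hh.1 hh.2)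
  -- t - 2c ≤ b - 2c < 0 < c, so t - 2c ≤ -c, i.e. t ≤ c; with t ≠ c: t < c; then h t ≠ 0 forces t ≤ -c,
  -- and t - 2c ≤ -3c < -b contradicts t - 2c ≥ -b.
  have h3 : t - 2 * c ≤ -c := by
    by_contra h3
    exact hnot2 ⟨not_le.1 h3, by linarith [ht1.2]⟩
  have h4 : t < c := lt_of_le_of_ne (by linarith) ht
  have h5 : t ≤ -c := by
    by_contra h5
    exact hnot1 ⟨not_le.1 h5, h4⟩
  linarith [ht2.1]

/-- Polarisation of the kernel: `k_{u+h} = k_u + k_h + (u ⋆ h̃) + (h ⋆ ũ)` for Weil test functions. [folklore] -/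
theorem weilConv_weilReflect_add (hu : IsWeilTest u) (hh : IsWeilTest h) :
    weilConv (u + h) (weilReflect (u + h)) =
      weilConv u (weilReflect u) + weilConv h (weilReflect h) +
        (weilConv u (weilReflect h) + weilConv h (weilReflect u)) := by
  rw [weilReflect_add, weilConv_add_left hu hh (hu.weilReflect.add hh.weilReflect),
    weilConv_add_right hu hu.weilReflect hh.weilReflect, weilConv_add_right hh hu.weilReflect hh.weilReflect]
  abel

/-- **The atom `q` is purely off-diagonal.** With `c = (log q)/2` (any `c > 0`): for a Weil test function `u` supported in
the inner window `[−c, c]` and an edge-layer Weil test function `h` (supported in `[−b, b]`, `b < 2c`, vanishing on `(−c, c)`),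
the spike of `g = u + h` at lag `2c = log q` is the CROSS term alone:
`k_{u+h}(2c) = (u ⋆ h̃)(2c) + (h ⋆ ũ)(2c)`. [this track, ATTEMPT-2 §2] -/
theorem weilConv_weilReflect_add_apply_two_mul (hu : IsWeilTest u) (hh : IsWeilTest h) {c b : ℝ} (hc : 0 < c)
    (hb : b < 2 * c) (hus : tsupport u ⊆ Icc (-c) c) (hhs : tsupport h ⊆ Icc (-b) b)
    (hcore : ∀ x : ℝ, -c < x → x < c → h x = 0) :
    weilConv (u + h) (weilReflect (u + h)) (2 * c) =
      weilConv u (weilReflect h) (2 * c) + weilConv h (weilReflect u) (2 * c) := by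
  rw [weilConv_weilReflect_add hu hh]
  simp only [Pi.add_apply]
  rw [weilConv_weilReflect_self_apply_two_mul hus, weilConv_weilReflect_edge_apply_two_mul hc hb hhs hcore]
  ring

/-- Hence the **contribution of `q` at `u + h` is an inner–edge cross term**:
`contribution q (u + h) = −(log q/√q)·2 Re X`, `X = (u ⋆ h̃)(log q) + (h ⋆ ũ)(log q)` (using `k(−x) = conj k(x)`),
for `u ∈ C((log q)/2)` and `h` an edge-layer function of a window `b < log q`. [this track, ATTEMPT-2 §2] -/
theorem contribution_add_eq_cross {q : ℕ} (hq : 1 < q) (hu : IsWeilTest u) (hh : IsWeilTest h) {b : ℝ}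
    (hb : b < Real.log q) (hus : tsupport u ⊆ Icc (-(Real.log q / 2)) (Real.log q / 2))
    (hhs : tsupport h ⊆ Icc (-b) b) (hcore : ∀ x : ℝ, -(Real.log q / 2) < x → x < Real.log q / 2 → h x = 0) :
    contribution q (u + h) =
      -(Real.log q / Real.sqrt q) *
        (2 * (weilConv u (weilReflect h) (Real.log q) + weilConv h (weilReflect u) (Real.log q)).re) := by
  have hc : 0 < Real.log q / 2 := by
    have : (1 : ℝ) < q := by exact_mod_cast hq
    have := Real.log_pos this
    positivity
  have h2c : Real.log q = 2 * (Real.log q / 2) := by ring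
  have hX : weilConv (u + h) (weilReflect (u + h)) (Real.log q) =
      weilConv u (weilReflect h) (Real.log q) + weilConv h (weilReflect u) (Real.log q) := by
    rw [h2c]
    exact weilConv_weilReflect_add_apply_two_mul hu hh hc (by linarith) hus hhs hcore
  have hneg : weilConv (u + h) (weilReflect (u + h)) (-Real.log q) =
      conj (weilConv (u + h) (weilReflect (u + h)) (Real.log q)) := by
    rw [← conj_weilConv_weilReflect_neg (u + h) (Real.log q), Complex.conj_conj]
  unfold contribution
  rw [hneg, hX, Complex.add_re, Complex.conj_re]
  ring

/-- The seat's `SliverBound` (stated in `HandoffSchur.lean`) HOLDS: it is `abs_re_weilConv_weilReflect_add_neg_le_sliver` of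
`HandoffSliver.lean`. [cite: Bombieri2000, §4 Lemma 2 (sharpened to the slivers)] -/
theorem sliverBound_holds : SliverBound :=
  fun _ _ x hg hsupp _ _ ↦ abs_re_weilConv_weilReflect_add_neg_le_sliver hg hsupp x

end Summit.RiemannHypothesis.RiemannHypothesis.Theorems.Handoff
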